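import Summits.Ventures.HodgeRepro2.T5SU11ResolventGroundStateWeight

/-!
# The weighted `L¹` bound of the resolvent at the ground-state weight `Ξ = φ_1`: the sharp constant `1/(λ − 1)²`

Row 551 bounds the resolvent on `L¹(φ_{λ′} sinh 2t dt)` with the constant `1/(μ − μ′)`, `1 < λ′ < λ`. At the EDGE weight
`Ξ = φ_1` row 556's row sums `∫ |K_λ(t, s)| Ξ(s) sinh 2s ds = Ξ(t)/(λ − 1)²` (transposed through the symmetry of the
kernel) and Fubini give, for a source `g` of the class (rate `ε > 2 − λ`) with **`|g| Ξ sinh 2s ∈ L¹(0, ∞)`**, every `λ > 1`: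

* `integrable_prod_kernel_abs_one` — `|K_λ(t, s)| |g(s)| sinh 2s · Ξ(t) sinh 2t` is integrable on `(0, ∞)²`;
* `abs_greenSolI_le_integral_abs` — the pointwise bound `|G^I_λ g(t)| ≤ ∫_s |K_λ(t, s)| |g(s)| sinh 2s ds`;
* `integrableOn_greenSolI_mul_sph_one_mul_sinh` — **`G^I_λ g · Ξ sinh 2t` is integrable on `(0, ∞)`**: the resolvent
  preserves `L¹(Ξ sinh 2t dt) ∩ class`;
* `integral_abs_greenSolI_mul_sph_one_mul_sinh_le` — **`∫ |G^I_λ g| Ξ sinh 2t ≤ (∫ |g| Ξ sinh 2s)/(λ − 1)²`** — the operator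
  norm of `(L − μ)⁻¹` on `L¹(Ξ sinh 2t dt)` is at most `1/(λ − 1)² = 1/dist(μ, −ρ²)`, the sharp constant, the same as on
  `L²(sinh 2t dt)` (row 549) and on the `Ξ`-weighted sup-norm space (row 556).

Nothing is claimed about (N).

Blind lane: Mathlib + the HodgeRepro2 prefix only; no sorry; axioms ⊆ {propext, Classical.choice,
Quot.sound}.
-/

namespace Summit.Ventures.HodgeRepro2.T5SU11ResolventL1GroundState

open Filter Topology MeasureTheory
open Set (Ioi Ioc)
open T5SU11Cartan T5SU11SphericalFunction T5SU11SphericalDecay T5SU11RadialGreenKernel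
  T5SU11RadialGreenImproper T5SU11RadialGreenImproperDecaySource T5SU11RadialGreenImproperStable
  T5SU11ResolventKernelComposition T5SU11ResolventTransformClass T5SU11RadialGreenPositivity
  T5SU11SphericalContinuous T5SU11SphericalBounds T5SU11ResolventGroundStateWeight

section measure

variable [MeasurableSpace Circle] [BorelSpace Circle]

variable {lam : ℝ} (hlam : 1 < lam)
  {g : ℝ → ℝ} (hg : ContinuousOn g (Ioi 0))
  {M : ℝ} (hM : ∀ s ∈ Ioc (0 : ℝ) 1, |g s| ≤ M) (hM0 : 0 ≤ M)
  {ε C s₀ : ℝ} (hε : 2 - lam < ε) (hC : ∀ s, s₀ ≤ s → |g s| ≤ C * Real.exp (-ε * s))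
  (hg1 : IntegrableOn (fun s => |g s| * sph 1 (hyp s) * Real.sinh (2 * s)) (Ioi 0))

include hlam hg hg1 in
/-- **The product integrand `|K_λ(t, s)| |g(s)| sinh 2s · Ξ(t) sinh 2t` is integrable on `(0, ∞)²`** for every
continuous source with `|g| Ξ sinh 2s ∈ L¹(0, ∞)`, `λ > 1`. -/
theorem integrable_prod_kernel_abs_one :
    Integrable (Function.uncurry fun t s => |sphGreenKernel lam t s| * (|g s| * Real.sinh (2 * s))
        * (sph 1 (hyp t) * Real.sinh (2 * t)))
      ((volume.restrict (Ioi 0)).prod (volume.restrict (Ioi 0))) := by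
  have hμ : 0 < (lam - 1) ^ 2 := by
    have : 0 < lam - 1 := by linarith
    positivity
  have hχ : ContinuousOn (sphDecay lam) (Ioi 0) :=
    fun _ hr => (hasDerivAt_sphDecay hlam hr).continuousAt.continuousWithinAt
  -- measurability: the integrand is continuous on the open quadrant
  have hmeas : AEStronglyMeasurable (Function.uncurry fun t s => |sphGreenKernel lam t s|
      * (|g s| * Real.sinh (2 * s)) * (sph 1 (hyp t) * Real.sinh (2 * t)))
      ((volume.restrict (Ioi 0)).prod (volume.restrict (Ioi 0))) := by
    rw [Measure.prod_restrict]
    refine ContinuousOn.aestronglyMeasurable ?_ (measurableSet_Ioi.prod measurableSet_Ioi)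
    have hK : ContinuousOn (fun p : ℝ × ℝ => sphGreenKernel lam p.1 p.2) (Ioi 0 ×ˢ Ioi 0) := by
      simp only [sphGreenKernel, greenKernel]
      apply ContinuousOn.neg
      apply ContinuousOn.mul
      · exact ((continuous_sph_hyp lam).comp (continuous_fst.min continuous_snd)).continuousOn
      · exact hχ.comp (continuous_fst.max continuous_snd).continuousOn
          (fun p hp => Set.mem_Ioi.mpr (lt_of_lt_of_le (Set.mem_Ioi.mp hp.1) (le_max_left _ _)))
    have hg' : ContinuousOn (fun p : ℝ × ℝ => g p.2) (Ioi 0 ×ˢ Ioi 0) :=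
      hg.comp continuous_snd.continuousOn (fun p hp => hp.2)
    have hφt : ContinuousOn (fun p : ℝ × ℝ => sph 1 (hyp p.1)) (Ioi 0 ×ˢ Ioi 0) :=
      ((continuous_sph_hyp 1).comp continuous_fst).continuousOn
    exact (hK.abs.mul (hg'.abs.mul
      (Real.continuous_sinh.comp (continuous_const.mul continuous_snd)).continuousOn)).mul
      (hφt.mul (Real.continuous_sinh.comp (continuous_const.mul continuous_fst)).continuousOn)
  rw [integrable_prod_iff' hmeas]
  refine ⟨?_, ?_⟩
  · -- for every `s > 0`, the weighted column `t ↦ |K_λ(t, s)| Ξ(t) sinh 2t · |g s| sinh 2s` is integrable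
    refine (ae_restrict_iff' measurableSet_Ioi).mpr (Eventually.of_forall fun s hs => ?_)
    have hs0 : 0 < s := hs
    have h : IntegrableOn (fun t => |sphGreenKernel lam s t| * sph 1 (hyp t) * Real.sinh (2 * t)
        * (|g s| * Real.sinh (2 * s))) (Ioi 0) :=
      (integrableOn_abs_sphGreenKernel_mul_sph_one hlam hs0).mul_const (|g s| * Real.sinh (2 * s))
    refine h.congr_fun (fun t _ => ?_) measurableSet_Ioi
    simp only [Function.uncurry_apply_pair]
    rw [sphGreenKernel_symm lam s t]
    ring
  · -- the outer function `s ↦ ∫_t ‖F(t, s)‖ dt = |g s| Ξ(s) sinh 2s/(λ − 1)²` is integrable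
    have hI := hg1.mul_const (1 / (lam - 1) ^ 2)
    refine hI.congr ?_
    refine (ae_restrict_iff' measurableSet_Ioi).mpr (Eventually.of_forall fun s hs => ?_)
    have hs0 : 0 < s := hs
    have hsinh : 0 ≤ Real.sinh (2 * s) := Real.sinh_nonneg_iff.mpr (by linarith)
    simp only
    have e : ∫ t in Ioi 0, ‖Function.uncurry (fun t s => |sphGreenKernel lam t s| * (|g s| * Real.sinh (2 * s))
        * (sph 1 (hyp t) * Real.sinh (2 * t))) (t, s)‖
        = ∫ t in Ioi 0, |sphGreenKernel lam s t| * sph 1 (hyp t) * Real.sinh (2 * t)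
          * (|g s| * Real.sinh (2 * s)) := by
      apply setIntegral_congr_fun measurableSet_Ioi
      intro t ht
      have ht0 : 0 < t := ht
      have hsinh_t : 0 ≤ Real.sinh (2 * t) := Real.sinh_nonneg_iff.mpr (by linarith)
      have hF0 : 0 ≤ |sphGreenKernel lam t s| * (|g s| * Real.sinh (2 * s)) * (sph 1 (hyp t) * Real.sinh (2 * t)) :=
        mul_nonneg (mul_nonneg (abs_nonneg _) (mul_nonneg (abs_nonneg _) hsinh))
          (mul_nonneg (sph_hyp_pos 1 t).le hsinh_t)
      simp only [Function.uncurry_apply_pair, Real.norm_eq_abs]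
      rw [abs_of_nonneg hF0, sphGreenKernel_symm lam t s]
      ring
    rw [e, MeasureTheory.integral_mul_const, integral_abs_sphGreenKernel_mul_sph_one hlam hs0]
    ring

include hlam hg hM hM0 hε hC in
/-- The pointwise bound `|G^I_λ g(t)| ≤ ∫_{(0,∞)} |K_λ(t, s)| |g(s)| sinh 2s ds` for every `t > 0` and every source of the
class (`λ > 1`). -/
theorem abs_greenSolI_le_integral_abs {t : ℝ} (ht : 0 < t) :
    |greenSolI (fun t => sph lam (hyp t)) (sphDecay lam) g t|
      ≤ ∫ s in Ioi 0, |sphGreenKernel lam t s| * (|g s| * Real.sinh (2 * s)) := by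
  have hB := integrableOn_sph_mul_mul_sinh_Ioc hg hM hM0 lam
  have hA := integrableOn_sphDecay_mul_mul_sinh hlam hg hM hM0 hε hC
  rw [greenSolI_eq_integral_kernel hB hA ht]
  change |∫ s in Ioi 0, sphGreenKernel lam t s * g s * Real.sinh (2 * s)| ≤ _
  calc |∫ s in Ioi 0, sphGreenKernel lam t s * g s * Real.sinh (2 * s)|
      ≤ ∫ s in Ioi 0, |sphGreenKernel lam t s * g s * Real.sinh (2 * s)| := by
        have := norm_integral_le_integral_norm (μ := volume.restrict (Ioi 0))
          (fun s => sphGreenKernel lam t s * g s * Real.sinh (2 * s))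
        simpa only [Real.norm_eq_abs] using this
    _ = ∫ s in Ioi 0, |sphGreenKernel lam t s| * (|g s| * Real.sinh (2 * s)) := by
        apply setIntegral_congr_fun measurableSet_Ioi
        intro s hs
        have hs0 : 0 < s := hs
        simp only
        rw [abs_mul, abs_mul, abs_of_nonneg (Real.sinh_nonneg_iff.mpr (by linarith : (0 : ℝ) ≤ 2 * s))]
        ring

include hlam hg hM hM0 hε hC hg1 in
/-- **THE RESOLVENT PRESERVES `L¹(Ξ sinh 2t dt)` FOR EVERY `λ > 1`**: `G^I_λ g · Ξ sinh 2t` is integrable on `(0, ∞)`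
for a source of the class with `|g| Ξ sinh 2s ∈ L¹(0, ∞)`. -/
theorem integrableOn_greenSolI_mul_sph_one_mul_sinh :
    IntegrableOn (fun t => greenSolI (fun t => sph lam (hyp t)) (sphDecay lam) g t * sph 1 (hyp t)
      * Real.sinh (2 * t)) (Ioi 0) := by
  have hF := integrable_prod_kernel_abs_one hlam hg hg1
  have hH := hF.integral_prod_left
  have hcont : ContinuousOn (fun t => greenSolI (fun t => sph lam (hyp t)) (sphDecay lam) g t * sph 1 (hyp t)
      * Real.sinh (2 * t)) (Ioi 0) :=
    ((continuousOn_greenSolI hlam hg hM hM0 hε hC).mul (continuous_sph_hyp 1).continuousOn).mul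
      (Real.continuous_sinh.comp (continuous_const.mul continuous_id)).continuousOn
  refine Integrable.mono' hH (hcont.aestronglyMeasurable measurableSet_Ioi) ?_
  refine (ae_restrict_iff' measurableSet_Ioi).mpr (Eventually.of_forall fun t ht => ?_)
  have ht0 : 0 < t := ht
  have hsinh : 0 ≤ Real.sinh (2 * t) := Real.sinh_nonneg_iff.mpr (by linarith)
  have hφ : 0 < sph 1 (hyp t) := sph_hyp_pos 1 t
  rw [Real.norm_eq_abs, abs_mul, abs_mul, abs_of_pos hφ, abs_of_nonneg hsinh]
  have e : ∫ s in Ioi 0, Function.uncurry (fun t s => |sphGreenKernel lam t s| * (|g s| * Real.sinh (2 * s))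
      * (sph 1 (hyp t) * Real.sinh (2 * t))) (t, s)
      = (∫ s in Ioi 0, |sphGreenKernel lam t s| * (|g s| * Real.sinh (2 * s))) * (sph 1 (hyp t) * Real.sinh (2 * t)) := by
    rw [← MeasureTheory.integral_mul_const]
    apply setIntegral_congr_fun measurableSet_Ioi
    intro s _
    simp only [Function.uncurry_apply_pair]
  rw [e, mul_assoc]
  exact mul_le_mul_of_nonneg_right (abs_greenSolI_le_integral_abs hlam hg hM hM0 hε hC ht0) (mul_nonneg hφ.le hsinh)

include hlam hg hM hM0 hε hC hg1 in
/-- **THE SHARP WEIGHTED `L¹` BOUND OF THE RESOLVENT FOR EVERY `λ > 1`**: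
`∫_{(0,∞)} |G^I_λ g| Ξ sinh 2t dt ≤ (∫_{(0,∞)} |g| Ξ sinh 2s ds)/(λ − 1)²` for every source of the class with
`|g| Ξ sinh 2s ∈ L¹(0, ∞)` — the operator norm of `(L − μ)⁻¹` on `L¹(Ξ sinh 2t dt)` is at most `1/(λ − 1)²`. -/
theorem integral_abs_greenSolI_mul_sph_one_mul_sinh_le :
    ∫ t in Ioi 0, |greenSolI (fun t => sph lam (hyp t)) (sphDecay lam) g t| * sph 1 (hyp t) * Real.sinh (2 * t)
      ≤ (∫ s in Ioi 0, |g s| * sph 1 (hyp s) * Real.sinh (2 * s)) / (lam - 1) ^ 2 := by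
  have hμ : 0 < (lam - 1) ^ 2 := by
    have : 0 < lam - 1 := by linarith
    positivity
  have hF := integrable_prod_kernel_abs_one hlam hg hg1
  have hswap := integral_integral_swap hF
  -- the left-hand side is dominated by the iterated integral
  have hleft : ∫ t in Ioi 0, |greenSolI (fun t => sph lam (hyp t)) (sphDecay lam) g t| * sph 1 (hyp t)
        * Real.sinh (2 * t)
      ≤ ∫ t in Ioi 0, ∫ s in Ioi 0, |sphGreenKernel lam t s| * (|g s| * Real.sinh (2 * s))
        * (sph 1 (hyp t) * Real.sinh (2 * t)) := by
    refine integral_mono_of_nonneg ?_ hF.integral_prod_left ?_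
    · exact ae_restrict_of_forall_mem measurableSet_Ioi (fun t ht =>
        mul_nonneg (mul_nonneg (abs_nonneg _) (sph_hyp_pos 1 t).le)
          (Real.sinh_nonneg_iff.mpr (by linarith [Set.mem_Ioi.mp ht])))
    · refine ae_restrict_of_forall_mem measurableSet_Ioi (fun t ht => ?_)
      have ht0 : 0 < t := ht
      have hsinh : 0 ≤ Real.sinh (2 * t) := Real.sinh_nonneg_iff.mpr (by linarith)
      have hφ : 0 < sph 1 (hyp t) := sph_hyp_pos 1 t
      have e : ∫ s in Ioi 0, |sphGreenKernel lam t s| * (|g s| * Real.sinh (2 * s)) * (sph 1 (hyp t) * Real.sinh (2 * t))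
          = (∫ s in Ioi 0, |sphGreenKernel lam t s| * (|g s| * Real.sinh (2 * s)))
            * (sph 1 (hyp t) * Real.sinh (2 * t)) := MeasureTheory.integral_mul_const _ _
      simp only
      rw [e, mul_assoc]
      exact mul_le_mul_of_nonneg_right (abs_greenSolI_le_integral_abs hlam hg hM hM0 hε hC ht0)
        (mul_nonneg hφ.le hsinh)
  -- the swapped iterated integral is `∫_s |g s| Ξ(s) sinh 2s/(λ − 1)²`
  have hright : ∫ s in Ioi 0, ∫ t in Ioi 0, |sphGreenKernel lam t s| * (|g s| * Real.sinh (2 * s))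
        * (sph 1 (hyp t) * Real.sinh (2 * t))
      = (∫ s in Ioi 0, |g s| * sph 1 (hyp s) * Real.sinh (2 * s)) / (lam - 1) ^ 2 := by
    rw [← MeasureTheory.integral_div]
    apply setIntegral_congr_fun measurableSet_Ioi
    intro s hs
    have hs0 : 0 < s := hs
    simp only
    have e : ∫ t in Ioi 0, |sphGreenKernel lam t s| * (|g s| * Real.sinh (2 * s)) * (sph 1 (hyp t) * Real.sinh (2 * t))
        = ∫ t in Ioi 0, |sphGreenKernel lam s t| * sph 1 (hyp t) * Real.sinh (2 * t) * (|g s| * Real.sinh (2 * s)) := by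
      apply setIntegral_congr_fun measurableSet_Ioi
      intro t _
      simp only
      rw [sphGreenKernel_symm lam t s]
      ring
    rw [e, MeasureTheory.integral_mul_const, integral_abs_sphGreenKernel_mul_sph_one hlam hs0]
    ring
  calc ∫ t in Ioi 0, |greenSolI (fun t => sph lam (hyp t)) (sphDecay lam) g t| * sph 1 (hyp t) * Real.sinh (2 * t)
      ≤ ∫ t in Ioi 0, ∫ s in Ioi 0, |sphGreenKernel lam t s| * (|g s| * Real.sinh (2 * s))
          * (sph 1 (hyp t) * Real.sinh (2 * t)) := hleft
    _ = ∫ s in Ioi 0, ∫ t in Ioi 0, |sphGreenKernel lam t s| * (|g s| * Real.sinh (2 * s))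
          * (sph 1 (hyp t) * Real.sinh (2 * t)) := hswap
    _ = (∫ s in Ioi 0, |g s| * sph 1 (hyp s) * Real.sinh (2 * s)) / (lam - 1) ^ 2 := hright

end measure

end Summit.Ventures.HodgeRepro2.T5SU11ResolventL1GroundState
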